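import Summits.QuantumFields.YangMills.Theses.UnitScaleTilt
import Literature.MathematicalPhysics.QuantumFieldTheory.Balaban1983to89.T3RestrictedUnitDensity
import Literature.MathematicalPhysics.QuantumFieldTheory.Balaban1983to89.B10

/-!
# Route `UnitScaleTilt` — crux K2 `HistoryTail` (stmt-QuantumFields-18916): FROM THE SANDWICH (41)/(47) TO A RATIO — the Gibbs mass of a
# height-`j` event over the partition function is at most `e^{2Rm_j}` times the (41)-history integral over the event divided by the
# trivial-history small-field integral of (47) (support file; sub-lemma S4 of the split card, typed at the `B10.TowerRun` level)

Fleet lead `ym-ust-18916-p1` (gen 0); split card `CARD-18916-K2-split.md` (evidence #12 on the item), sub-lemma **S4** in its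
representation-independent form (director-ym LINE №58).  Mechanism A of the owner's K2 memo bounds
`Gibbs_K{E} = (∫_E ρ_j)/(∫ ρ_j)` (density transfer, S1, file `UnitScaleTiltHistoryTailDensityTransfer` + `partitionFn_eq_integral_resDensity`
below) by dividing Bałaban's UPPER representation (41) of `ρ_j` ([Balaban1985UV3] p.266; tree display `B10.Ineq41`: `ρ_j ≤ LF_j[−mainT + Pint
− E_j + Zterm + Rm_j]`) by his LOWER bound (47) (p.267; `B10.Ineq47`: `χ_j·exp(−mainT(triv) + Pint(triv) − E_j − Rm_j) ≤ ρ_j`): the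
vacuum-energy constant `E_j` of (62)/(64) CANCELS exactly and the remainders `Rm_j = Σ_{i<j} O((L^iε)^{3+κ₀})|T₁^{(i)}|` (cutoff-uniform,
volume-dependent — memo caveat (v)) cost `e^{2Rm_j}`.

THIS FILE proves exactly that bookkeeping, for ANY carrier `T : B10.TowerRun` satisfying `Ineq41 T k ∧ Ineq47 T k`, any measure on `T.Cfg k`
and any event `E` (**`ratio_le_of_ineq41_47`**; monotonicity + `lf_shift` + `χ ≥ 0`), and the identity `Z_K = ∫ ρ_j` for the route's
densities (**`partitionFn_eq_integral_resDensity`**, mass preservation of the `j`-fold (0.4) push-forward, from `integral_resDensity_mul`).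
The two located pieces of mechanism A — the small factor `exp(−¼p(g)²)` of (71) inside `∫_E LF_j[…]` (S3) and the decoupling of that
history integral from the trivial-history integral outside `N(p)` (S5, unprinted) — are NOT here; nor is the socket identifying the route's
`resDensity … univ j` with the `ρ j` of a `TowerRun` carrying (41)/(47) (S2, the owner's R1/R2/R3 ruling).  Nothing uses (α).
-/

noncomputable section

open MeasureTheory
open Literature.MathematicalPhysics.QuantumFieldTheory.Balaban1983to89
open Literature.MathematicalPhysics.QuantumFieldTheory.Balaban1983to89.T3ContinuumYM3Torus
open Literature.MathematicalPhysics.QuantumFieldTheory.Balaban1983to89.T3UnitScaleTilt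
open Literature.MathematicalPhysics.QuantumFieldTheory.Balaban1983to89.T3UnitLawDensityEML
open Literature.MathematicalPhysics.QuantumFieldTheory.Balaban1983to89.T3RestrictedUnitDensity
open Literature.MathematicalPhysics.QuantumFieldTheory.Balaban1983to89.Missing (boltzmann partitionFn)

namespace Summit.QuantumFields.YangMills.Theorems.HistoryTailSandwich

/-! ## §1 The sandwich-to-ratio bookkeeping over `B10.TowerRun` -/

section Ratio

variable (T : B10.TowerRun) (k : ℕ)

/-- **(41) WITH THE CONSTANTS PULLED OUT**: `ρ_k(U) ≤ e^{−E_k + Rm_k}·LF_k(U)[−mainT + Pint + Zterm]` (`lf_shift`). [cite: Balaban1985UV3, (41) p.266] -/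
theorem rho_le_of_ineq41 (h41 : B10.Ineq41 T k) (U : T.Cfg k) :
    T.ρ k U ≤ Real.exp (-T.Ecst k + T.Rm k) * T.LF k U (fun h => -(T.mainT k h U) + T.Pint k h U + T.Zterm k h) := by
  have h := h41 U
  have hfun : (fun h => -(T.mainT k h U) + T.Pint k h U - T.Ecst k + T.Zterm k h + T.Rm k) =
      (fun h => (-(T.mainT k h U) + T.Pint k h U + T.Zterm k h) + (-T.Ecst k + T.Rm k)) := by
    funext h; ring
  rwa [hfun, T.lf_shift] at h

/-- **(47) WITH THE CONSTANTS PULLED OUT**: `e^{−E_k − Rm_k}·χ_k(U)e^{−mainT(triv) + Pint(triv)} ≤ ρ_k(U)`. [cite: Balaban1985UV3, (47) p.267] -/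
theorem le_rho_of_ineq47 (h47 : B10.Ineq47 T k) (U : T.Cfg k) :
    Real.exp (-T.Ecst k - T.Rm k) *
        (T.χ k U * Real.exp (-(T.mainT k (T.triv k) U) + T.Pint k (T.triv k) U)) ≤ T.ρ k U := by
  have h := h47 U
  have hexp : Real.exp (-(T.mainT k (T.triv k) U) + T.Pint k (T.triv k) U - T.Ecst k - T.Rm k) =
      Real.exp (-(T.mainT k (T.triv k) U) + T.Pint k (T.triv k) U) * Real.exp (-T.Ecst k - T.Rm k) := by
    rw [← Real.exp_add]; ring_nf
  rw [hexp] at h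
  linarith [h]

/-- `ρ_k ≥ 0` from (47) (`χ_k ≥ 0`). [cite: Balaban1985UV3, (47) p.267] -/
theorem rho_nonneg_of_ineq47 (h47 : B10.Ineq47 T k) (U : T.Cfg k) : 0 ≤ T.ρ k U :=
  (mul_nonneg (Real.exp_nonneg _) (mul_nonneg (T.χ_nonneg k U) (Real.exp_nonneg _))).trans (le_rho_of_ineq47 T k h47 U)

variable [MeasurableSpace (T.Cfg k)] (μ : Measure (T.Cfg k)) (E : Set (T.Cfg k))

/-- **FROM THE SANDWICH TO THE RATIO** (sub-lemma S4): if `ρ_k` satisfies (41) and (47), then for every measure `μ` on the level-`k`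
configurations and every event `E` (integrability as stated, small-field integral of the trivial history positive),
`(∫_E ρ_k)/(∫ ρ_k) ≤ e^{2Rm_k} · (∫_E LF_k[−mainT + Pint + Zterm]) / (∫ χ_k e^{−mainT(triv) + Pint(triv)})` — `E_k` cancels.
[cite: Balaban1985UV3, (41) p.266 and (47) p.267] -/
theorem ratio_le_of_ineq41_47 (h41 : B10.Ineq41 T k) (h47 : B10.Ineq47 T k)
    (hρ : Integrable (T.ρ k) μ)
    (hUp : IntegrableOn (fun U => T.LF k U (fun h => -(T.mainT k h U) + T.Pint k h U + T.Zterm k h)) E μ)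
    (hLo : Integrable (fun U => T.χ k U * Real.exp (-(T.mainT k (T.triv k) U) + T.Pint k (T.triv k) U)) μ)
    (hpos : 0 < ∫ U, T.χ k U * Real.exp (-(T.mainT k (T.triv k) U) + T.Pint k (T.triv k) U) ∂μ) :
    (∫ U in E, T.ρ k U ∂μ) / (∫ U, T.ρ k U ∂μ) ≤
      Real.exp (2 * T.Rm k) *
        ((∫ U in E, T.LF k U (fun h => -(T.mainT k h U) + T.Pint k h U + T.Zterm k h) ∂μ) /
          ∫ U, T.χ k U * Real.exp (-(T.mainT k (T.triv k) U) + T.Pint k (T.triv k) U) ∂μ) := by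
  set A : ℝ := ∫ U in E, T.LF k U (fun h => -(T.mainT k h U) + T.Pint k h U + T.Zterm k h) ∂μ with hA
  set B : ℝ := ∫ U, T.χ k U * Real.exp (-(T.mainT k (T.triv k) U) + T.Pint k (T.triv k) U) ∂μ with hB
  set N : ℝ := ∫ U in E, T.ρ k U ∂μ with hN
  set D : ℝ := ∫ U, T.ρ k U ∂μ with hD
  -- numerator: `N ≤ e^{−E+Rm} A`
  have hNle : N ≤ Real.exp (-T.Ecst k + T.Rm k) * A := by
    rw [hN, hA, ← integral_const_mul]
    exact setIntegral_mono hρ.integrableOn (hUp.const_mul _) fun U => rho_le_of_ineq41 T k h41 U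
  -- denominator: `e^{−E−Rm} B ≤ D`, and `N ≥ 0`
  have hDge : Real.exp (-T.Ecst k - T.Rm k) * B ≤ D := by
    rw [hB, hD, ← integral_const_mul]
    exact integral_mono (hLo.const_mul _) hρ fun U => le_rho_of_ineq47 T k h47 U
  have hN0 : 0 ≤ N := integral_nonneg fun U => rho_nonneg_of_ineq47 T k h47 U
  have hB0 : 0 < B := hpos
  have hD' : 0 < Real.exp (-T.Ecst k - T.Rm k) * B := mul_pos (Real.exp_pos _) hB0
  have hD0 : 0 < D := hD'.trans_le hDge
  -- divide
  calc N / D ≤ N / (Real.exp (-T.Ecst k - T.Rm k) * B) := div_le_div_of_nonneg_left hN0 hD' hDge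
    _ ≤ Real.exp (-T.Ecst k + T.Rm k) * A / (Real.exp (-T.Ecst k - T.Rm k) * B) :=
        div_le_div_of_nonneg_right hNle hD'.le
    _ = Real.exp (2 * T.Rm k) * (A / B) := by
        have hsplit : Real.exp (-T.Ecst k + T.Rm k) = Real.exp (2 * T.Rm k) * Real.exp (-T.Ecst k - T.Rm k) := by
          rw [← Real.exp_add]; ring_nf
        rw [hsplit]
        field_simp

end Ratio

/-! ## §2 The route's partition function is the total mass of every renormalised density -/

section Mass

variable (F : T3Family) {γ : ℝ}

/-- **`Z_K = ∫ ρ_j`**: the `j`-fold renormalised density of the route (`resDensity F γ K univ j`, Bałaban's un-normalised `T^jρ₀` for the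
averaging `ℰp`) has total Haar mass `Z_K` for every `j ≤ m + K` (remark (6) p.257: «∫dU ρ_k = ∫dU T^kρ₀ = ∫dU ρ₀ = Z^ε»).
[cite: Balaban1985UV3, (6) p.257] -/
theorem partitionFn_eq_integral_resDensity (hγ : 0 ≤ γ) {K j : ℕ} (hj : j ≤ F.m + K) :
    partitionFn (G := Matrix.specialUnitaryGroup (Fin 2) ℂ) (F.P K) ((F.scheme ℰp γ).β K) =
      ∫ W, resDensity F γ K Set.univ j W ∂fieldMeasure (F.P K) j (Matrix.specialUnitaryGroup (Fin 2) ℂ) := by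
  have h := integral_resDensity_mul F K MeasurableSet.univ hγ hj (fun _ => (1 : ℝ)) measurable_const ⟨1, fun _ => by simp⟩
  simp only [mul_one, Set.indicator_univ] at h
  rw [h]
  rfl

end Mass

end Summit.QuantumFields.YangMills.Theorems.HistoryTailSandwich

end
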